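import Summits.QuantumFields.YangMills.Theorems.FluctuationComparisonRegPrIntLS2BetaSeamSectorExactness
import Summits.QuantumFields.YangMills.Theorems.UnitScaleTiltProp7NestedMeanParallelLiftDiagSplit
import HarnessLib

/-!
# (RG-K) THE ℤ₂ SEAM TWIST, VIII — THE WINDOW TRICHOTOMY READ FOR THE (T)-CHAIN: every datum is IRREDUCIBLE, or GAUGE-ABELIAN OF CASE A, or has
# CENTRAL CLOSED-WALK HOLONOMY (case B) — and in the third case EXW∘ ∕ TUBE♭ ∕ GAP♭ hold OUTRIGHT (parts V–VII); so the registered organs are OPEN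
# only on the first two strata

Helper for crux `stmt-QuantumFields-20520` (`Theses.UnitScaleTilt.FluctuationComparisonRegPrIntL`), the (T)-chain of LINE `semiclassical_s2beta` (cell
`ym3-torus`, width seat «width 16» px16 g18).  The tree's algebraic trichotomy of `SU(2)` lattice data (zero hypotheses): ✓`onlyScalar_or_exists_gauge_
commute_sigma3` (every parallel section scalar = IRR, or some gauge transform is `σ₃`-diagonal) and, for diagonal data, ✓`parallelConstDiag_or_loopHol_central`
(parallel sections constant-diagonal = case A, or every closed-walk holonomy at some base point is central = case B).  §1 observes that case B is a GAUGE-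
INVARIANT condition (`loopHol_central_of_gaugeAct`: closed-walk holonomies conjugate by `g(x₀)`, and a central value is fixed by conjugation), so the third
alternative can be read on `V` itself: ★★ `irr_or_caseA_or_loopHol_central`.  §2 plugs parts VI–VII: ★★★★ `irr_or_caseA_or_windowExactness`,
★★★★ `exists_gapFlat_unless_irr_or_caseA`, ★★★★ `exists_tubeGrowth_unless_irr_or_caseA` — at every `2`-small window datum the organs EXW∘ ∕ GAP♭ ∕ TUBE♭
(at every minimiser base point) hold OUTRIGHT unless the datum is irreducible or gauge-abelian of case A, where the neighbours' thresholded roads apply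
(✓px21 (T7a–f) ∕ ✓pen 4, 7 at `L ≥ 5`; ✓px12 FILES 3–7 ∕ ✓px17 `…GapFlatOfRegAb` at `L ≥ 5` modulo REG^{ab}).

HONEST: composition of landed letters and the tree's algebraic trichotomy; nothing of Bałaban's analysis; the two remaining strata carry ALL the analytic
content of [Balaban1985Variational] Thm 1 ∕ Prop. 7; no stub of the line is proved — EXW∘, GAP♯∘ (K-uniform), TUBE-REG∘, S2β and crux 20520 stay OPEN;
rung R3 (YM₃ on T³) is NOT d = 4, NOT infinite volume, NOT a mass gap, NOT Clay; the Yang–Mills mass gap is NOT proved.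
-/

set_option autoImplicit false

noncomputable section

open Set Function
open scoped Matrix.Norms.L2Operator
open Literature.MathematicalPhysics.QuantumFieldTheory.Balaban1983to89
open Literature.MathematicalPhysics.QuantumFieldTheory.Balaban1983to89.T4Continuum
open Literature.MathematicalPhysics.QuantumFieldTheory.Balaban1983to89.B10Eq27TorusAxialLog (unitsField toUField)
open Literature.MathematicalPhysics.QuantumFieldTheory.Balaban1983to89.B9AdOrthogonal (σ₃)
open Literature.MathematicalPhysics.QuantumFieldTheory.Balaban1983to89.T3ContinuumYM3Torus
open Literature.MathematicalPhysics.QuantumFieldTheory.Balaban1983to89.T3UnitLawDensityEML (ℰp)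
open Literature.MathematicalPhysics.QuantumFieldTheory.Balaban1983to89.T3UnitScaleTilt
open Literature.MathematicalPhysics.QuantumFieldTheory.Balaban1983to89.T3TiltDescent
open Literature.MathematicalPhysics.QuantumFieldTheory.Balaban1983to89.T3ConstrainedMinimiser (fibre)
open Literature.MathematicalPhysics.QuantumFieldTheory.Balaban1983to89.T3PrintedRegularMinimiser
open Literature.MathematicalPhysics.QuantumFieldTheory.Balaban1983to89.T3PrintedRegularOrbits
open scoped Literature.MathematicalPhysics.QuantumFieldTheory.Balaban1983to89.T3OrbitAverage
open Literature.MathematicalPhysics.QuantumFieldTheory.Balaban1983to89.ExpMeanLog (deltaSU)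
open Summit.QuantumFields.YangMills.Theorems.Prop7NestedMeanParallelLiftDiagGauge (onlyScalar_or_exists_gauge_commute_sigma3 parallelConstDiag_or_loopHol_central)
open Summit.QuantumFields.YangMills.Theorems.FluctuationComparisonRegPrIntLS2BetaSeamSectorMinimisers (exists_tubeGrowth_caseB_atMin exists_gapFlat_caseB_atMin)
open Summit.QuantumFields.YangMills.Theorems.FluctuationComparisonRegPrIntLS2BetaSeamSectorExactness (windowExactness_caseB)

namespace Summit.QuantumFields.YangMills.Theorems.FluctuationComparisonRegPrIntLS2BetaWindowStrataCaseB

/-! ## §1 Case B is gauge invariant; the trichotomy read on the datum itself -/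

section Trichotomy

variable {P : Params}

/-- **Central closed-walk holonomy is a gauge-invariant condition**: if every closed-walk holonomy of `g • V` at `x₀` is central, so is every closed-walk
holonomy of `V` at `x₀` (lit ✓`holAt_gaugeAct_walk`: they are conjugate by `g x₀`, and conjugation fixes a central value). [cite: Balaban1985Averaging, (8)-(9) p.19] -/
theorem loopHol_central_of_gaugeAct (g : GaugeTransf P 0 (Matrix.specialUnitaryGroup (Fin 2) ℂ)) (V : GaugeField P 0 (Matrix.specialUnitaryGroup (Fin 2) ℂ)) (x₀ : Site P 0)
    (hcen : ∀ w : List (Letter P.d), walkEnd x₀ w = x₀ →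
      ∀ M : Matrix (Fin 2) (Fin 2) ℂ, Commute ((holAt (GaugeField.gaugeAct g V) (walk x₀ w) : Matrix.specialUnitaryGroup (Fin 2) ℂ) : Matrix (Fin 2) (Fin 2) ℂ) M) :
    ∀ w : List (Letter P.d), walkEnd x₀ w = x₀ →
      ∀ M : Matrix (Fin 2) (Fin 2) ℂ, Commute ((holAt V (walk x₀ w) : Matrix.specialUnitaryGroup (Fin 2) ℂ) : Matrix (Fin 2) (Fin 2) ℂ) M := by
  intro w hw M
  have hconj : holAt (GaugeField.gaugeAct g V) (walk x₀ w) = g x₀ * holAt V (walk x₀ w) * (g x₀)⁻¹ := by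
    rw [holAt_gaugeAct_walk g V x₀ w, hw]
  -- the conjugate is central, hence equal to the holonomy itself
  have hc := hcen w hw ((g x₀ : Matrix.specialUnitaryGroup (Fin 2) ℂ) : Matrix (Fin 2) (Fin 2) ℂ)
  rw [hconj] at hc
  have heq : g x₀ * holAt V (walk x₀ w) * (g x₀)⁻¹ = holAt V (walk x₀ w) := by
    have h1 : (g x₀ * holAt V (walk x₀ w) * (g x₀)⁻¹) * g x₀ = g x₀ * (g x₀ * holAt V (walk x₀ w) * (g x₀)⁻¹) := by
      apply Subtype.ext
      simpa only [Submonoid.coe_mul] using hc.eq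
    have h2 : g x₀ * holAt V (walk x₀ w) = g x₀ * (g x₀ * holAt V (walk x₀ w) * (g x₀)⁻¹) := by
      rw [← h1, inv_mul_cancel_right]
    exact (mul_left_cancel h2).symm
  have hc' := hcen w hw M
  rw [hconj, heq] at hc'
  exact hc'

/-- ★★ **THE WINDOW TRICHOTOMY, READ ON THE DATUM** (zero hypotheses, every `SU(2)` lattice datum): every parallel section of `V` is scalar (IRREDUCIBLE), OR a
gauge transform of `V` is `σ₃`-diagonal with constant-diagonal parallel sections (CASE A), OR every closed-walk holonomy of `V` ITSELF at some base point
is central (CASE B) — ✓`onlyScalar_or_exists_gauge_commute_sigma3` ∘ ✓`parallelConstDiag_or_loopHol_central` ∘ §1. [cite: Balaban1985Variational, (4) p.278] -/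
theorem irr_or_caseA_or_loopHol_central (V : GaugeField P 0 (Matrix.specialUnitaryGroup (Fin 2) ℂ)) :
    (∀ c : Site P 0 → Matrix (Fin 2) (Fin 2) ℂ,
          (∀ e : PBond P 0, c e.src = ((unitsField (toUField V) e : (Matrix (Fin 2) (Fin 2) ℂ)ˣ) : Matrix (Fin 2) (Fin 2) ℂ) * c e.tgt *
            (((unitsField (toUField V) e)⁻¹ : (Matrix (Fin 2) (Fin 2) ℂ)ˣ) : Matrix (Fin 2) (Fin 2) ℂ)) →
          ∃ z : ℂ, ∀ y, c y = z • (1 : Matrix (Fin 2) (Fin 2) ℂ)) ∨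
    (∃ g : GaugeTransf P 0 (Matrix.specialUnitaryGroup (Fin 2) ℂ),
          (∀ e : PBond P 0, Commute (((GaugeField.gaugeAct g V) e : Matrix.specialUnitaryGroup (Fin 2) ℂ) : Matrix (Fin 2) (Fin 2) ℂ) σ₃) ∧
          ∀ c : Site P 0 → Matrix (Fin 2) (Fin 2) ℂ,
            (∀ e : PBond P 0, c e.src = ((unitsField (toUField (GaugeField.gaugeAct g V)) e : (Matrix (Fin 2) (Fin 2) ℂ)ˣ) : Matrix (Fin 2) (Fin 2) ℂ) * c e.tgt *
            (((unitsField (toUField (GaugeField.gaugeAct g V)) e)⁻¹ : (Matrix (Fin 2) (Fin 2) ℂ)ˣ) : Matrix (Fin 2) (Fin 2) ℂ)) →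
            ∃ c₀ : Matrix (Fin 2) (Fin 2) ℂ, (∀ y, c y = c₀) ∧ Commute c₀ σ₃) ∨
    (∃ x₀ : Site P 0, ∀ w : List (Letter P.d), walkEnd x₀ w = x₀ →
          ∀ M : Matrix (Fin 2) (Fin 2) ℂ, Commute ((holAt V (walk x₀ w) : Matrix.specialUnitaryGroup (Fin 2) ℂ) : Matrix (Fin 2) (Fin 2) ℂ) M) := by
  rcases onlyScalar_or_exists_gauge_commute_sigma3 V with hirr | ⟨g, hdiag⟩
  · exact Or.inl hirr
  · rcases parallelConstDiag_or_loopHol_central (GaugeField.gaugeAct g V) hdiag with hA | ⟨y₀, hB⟩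
    · exact Or.inr (Or.inl ⟨g, hdiag, hA⟩)
    · exact Or.inr (Or.inr ⟨y₀, loopHol_central_of_gaugeAct g V y₀ hB⟩)

end Trichotomy

/-! ## §2 The organs of the (T)-chain at every window datum, unless irreducible or case A -/

variable (F : T3Family) {J K : ℕ}

/-- ★★★★ **EXW∘ AT EVERY `2`-SMALL WINDOW DATUM UNLESS IRREDUCIBLE OR CASE A** (for every `0 < γ ≤ 1`, `0 < b₀`, `p₀`, `0 < ε₀`, `J ≤ K`, any `L`; ✓part VII
`windowExactness_caseB` on the third stratum). [cite: Balaban1985Variational, Thm 1 (8) p.279, (4)-(6) p.278] -/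
theorem irr_or_caseA_or_windowExactness (hJK : J ≤ K) {γ b₀ p₀ ε₀ : ℝ} (hγ : 0 < γ) (hγ1 : γ ≤ 1) (hb : 0 < b₀) (hε₀ : 0 < ε₀)
    (V : GaugeField (F.P J) 0 (Matrix.specialUnitaryGroup (Fin 2) ℂ)) {δ : ℝ} (hδ : δ ≤ 2) (hV : PlaqSmall δ V) :
    (∀ c : Site (F.P J) 0 → Matrix (Fin 2) (Fin 2) ℂ,
          (∀ e : PBond (F.P J) 0, c e.src = ((unitsField (toUField V) e : (Matrix (Fin 2) (Fin 2) ℂ)ˣ) : Matrix (Fin 2) (Fin 2) ℂ) * c e.tgt *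
            (((unitsField (toUField V) e)⁻¹ : (Matrix (Fin 2) (Fin 2) ℂ)ˣ) : Matrix (Fin 2) (Fin 2) ℂ)) →
          ∃ z : ℂ, ∀ y, c y = z • (1 : Matrix (Fin 2) (Fin 2) ℂ)) ∨
    (∃ g : GaugeTransf (F.P J) 0 (Matrix.specialUnitaryGroup (Fin 2) ℂ),
          (∀ e : PBond (F.P J) 0, Commute (((GaugeField.gaugeAct g V) e : Matrix.specialUnitaryGroup (Fin 2) ℂ) : Matrix (Fin 2) (Fin 2) ℂ) σ₃) ∧
          ∀ c : Site (F.P J) 0 → Matrix (Fin 2) (Fin 2) ℂ,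
            (∀ e : PBond (F.P J) 0, c e.src = ((unitsField (toUField (GaugeField.gaugeAct g V)) e : (Matrix (Fin 2) (Fin 2) ℂ)ˣ) : Matrix (Fin 2) (Fin 2) ℂ) * c e.tgt *
            (((unitsField (toUField (GaugeField.gaugeAct g V)) e)⁻¹ : (Matrix (Fin 2) (Fin 2) ℂ)ˣ) : Matrix (Fin 2) (Fin 2) ℂ)) →
            ∃ c₀ : Matrix (Fin 2) (Fin 2) ℂ, (∀ y, c y = c₀) ∧ Commute c₀ σ₃) ∨
    ((∀ U ∈ fibre F ℰp J K hJK V, U ∈ histGood F ℰp (θBal F.L γ b₀ p₀) K J →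
        minActionRegPr F J K hJK ε₀ V ≤ wilsonAction4 U) ∧
     (∃ U₀ ∈ regFibrePr F J K hJK ε₀ V, U₀ ∈ histGood F ℰp (θBal F.L γ b₀ p₀) K J ∧
        wilsonAction4 U₀ = minActionRegPr F J K hJK ε₀ V)) := by
  rcases irr_or_caseA_or_loopHol_central V with hirr | hA | ⟨x₀, hcen⟩
  · exact Or.inl hirr
  · exact Or.inr (Or.inl hA)
  · exact Or.inr (Or.inr (windowExactness_caseB F hJK hγ hγ1 hb hε₀ V x₀ hcen hδ hV))

/-- ★★★★ **GAP♭ AT EVERY `2`-SMALL WINDOW DATUM AND EVERY MINIMISER BASE POINT, UNLESS IRREDUCIBLE OR CASE A** (✓p799103's regime and `γ₁(L, b₀, p₀, δ')`,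
same `μ`; any `L`; ✓part VI `exists_gapFlat_caseB_atMin` on the third stratum). [cite: Balaban1985Variational, (142) p.299, Prop. 7 p.299; Balaban1984PropagatorsII, (1.33); Balaban1985UV3, (12)-(13) p.259] -/
theorem exists_gapFlat_unless_irr_or_caseA (L : ℕ) (b₀ p₀ : ℝ) (hb : 0 < b₀) (hp : 0 < p₀) (δ' : ℝ) (hδ' : 0 < δ') :
    ∃ γ₁ : ℝ, 0 < γ₁ ∧ ∀ (F : T3Family) (γ : ℝ), F.L = L → 0 < γ → γ ≤ γ₁ →
      ∀ (J K : ℕ) (hlt : J < K) (hk : K - J ≤ (F.P K).m + (F.P K).K)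
        (ε₀ : ℝ), 0 < ε₀ → (143 * ((((3 + 4 : ℕ) : ℝ)) ^ 2 / 4) ^ 2) * (2 * ε₀) ≤ 1 / 3 →
          2 * (2 * ε₀) ≤ 2 * deltaSU (Fin 2) / (((3 + 4) * F.L : ℕ) : ℝ) ^ 2 →
        ∀ (V : GaugeField (F.P J) 0 (Matrix.specialUnitaryGroup (Fin 2) ℂ)) (δ : ℝ), δ ≤ 2 → PlaqSmall δ V →
          (∀ c : Site (F.P J) 0 → Matrix (Fin 2) (Fin 2) ℂ,
          (∀ e : PBond (F.P J) 0, c e.src = ((unitsField (toUField V) e : (Matrix (Fin 2) (Fin 2) ℂ)ˣ) : Matrix (Fin 2) (Fin 2) ℂ) * c e.tgt *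
            (((unitsField (toUField V) e)⁻¹ : (Matrix (Fin 2) (Fin 2) ℂ)ˣ) : Matrix (Fin 2) (Fin 2) ℂ)) →
          ∃ z : ℂ, ∀ y, c y = z • (1 : Matrix (Fin 2) (Fin 2) ℂ)) ∨
          (∃ g : GaugeTransf (F.P J) 0 (Matrix.specialUnitaryGroup (Fin 2) ℂ),
          (∀ e : PBond (F.P J) 0, Commute (((GaugeField.gaugeAct g V) e : Matrix.specialUnitaryGroup (Fin 2) ℂ) : Matrix (Fin 2) (Fin 2) ℂ) σ₃) ∧
          ∀ c : Site (F.P J) 0 → Matrix (Fin 2) (Fin 2) ℂ,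
            (∀ e : PBond (F.P J) 0, c e.src = ((unitsField (toUField (GaugeField.gaugeAct g V)) e : (Matrix (Fin 2) (Fin 2) ℂ)ˣ) : Matrix (Fin 2) (Fin 2) ℂ) * c e.tgt *
            (((unitsField (toUField (GaugeField.gaugeAct g V)) e)⁻¹ : (Matrix (Fin 2) (Fin 2) ℂ)ˣ) : Matrix (Fin 2) (Fin 2) ℂ)) →
            ∃ c₀ : Matrix (Fin 2) (Fin 2) ℂ, (∀ y, c y = c₀) ∧ Commute c₀ σ₃) ∨
          ∀ U₀ : GaugeField (F.P K) 0 (Matrix.specialUnitaryGroup (Fin 2) ℂ), U₀ ∈ regFibrePr F J K hlt.le ε₀ V →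
            wilsonAction4 U₀ = minActionRegPr F J K hlt.le ε₀ V →
          ∃ μ : ℝ, 0 < μ ∧ ∀ U ∈ fibre F ℰp J K hlt.le V,
          U ∈ histGood F ℰp (θBal F.L γ b₀ p₀) K J →
        μ * ((F.L : ℝ)⁻¹) ^ (2 * (K - J)) *
        (⨅ w : {w : Site (F.P K) 0 → Matrix.specialUnitaryGroup (Fin 2) ℂ |
        ∀ U : GaugeField (F.P K) 0 (Matrix.specialUnitaryGroup (Fin 2) ℂ),
        descendTo F ℰp J K hlt.le (GaugeField.gaugeAct w U) = descendTo F ℰp J K hlt.le U},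
        ∑ ℓ : PBond (F.P K) 0,
        dist1 (U ℓ * ((GaugeField.gaugeAct (w : Site (F.P K) 0 → Matrix.specialUnitaryGroup (Fin 2) ℂ)
          U₀) ℓ)⁻¹) ^ 2)
        ≤ wilsonAction4 U - minActionRegPr F J K hlt.le ε₀ V := by
  obtain ⟨γ₁, hγ₁, hmain⟩ := exists_gapFlat_caseB_atMin L b₀ p₀ hb hp δ' hδ'
  refine ⟨γ₁, hγ₁, ?_⟩
  intro F γ hFL hγ hγle J K hlt hk ε₀ hε₀ hr3 hr2 V δ hδ hV
  rcases irr_or_caseA_or_loopHol_central V with hirr | hA | ⟨x₀, hcen⟩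
  · exact Or.inl hirr
  · exact Or.inr (Or.inl hA)
  · exact Or.inr (Or.inr fun U₀ hU₀ hmin => hmain F γ hFL hγ hγle J K hlt hk ε₀ hε₀ hr3 hr2 V x₀ hcen δ hδ hV U₀ hU₀ hmin)

/-- ★★★★ **TUBE♭ AT EVERY `2`-SMALL WINDOW DATUM AND EVERY MINIMISER BASE POINT, UNLESS IRREDUCIBLE OR CASE A** (every radius `δ'`; ✓p799103's regime and
`γ₁(L, b₀, p₀)`, same `μ`; any `L`; ✓part VI `exists_tubeGrowth_caseB_atMin`). [cite: Balaban1985Variational, (142) p.299, Prop. 7 p.299; Balaban1985UV3, (12)-(13) p.259, (18)-(22) p.260] -/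
theorem exists_tubeGrowth_unless_irr_or_caseA (L : ℕ) (b₀ p₀ : ℝ) (hb : 0 < b₀) (hp : 0 < p₀) :
    ∃ γ₁ : ℝ, 0 < γ₁ ∧ ∀ (F : T3Family) (γ : ℝ), F.L = L → 0 < γ → γ ≤ γ₁ →
      ∀ (J K : ℕ) (hlt : J < K) (hk : K - J ≤ (F.P K).m + (F.P K).K)
        (ε₀ : ℝ), 0 < ε₀ → (143 * ((((3 + 4 : ℕ) : ℝ)) ^ 2 / 4) ^ 2) * (2 * ε₀) ≤ 1 / 3 →
          2 * (2 * ε₀) ≤ 2 * deltaSU (Fin 2) / (((3 + 4) * F.L : ℕ) : ℝ) ^ 2 →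
        ∀ (V : GaugeField (F.P J) 0 (Matrix.specialUnitaryGroup (Fin 2) ℂ)) (δ : ℝ), δ ≤ 2 → PlaqSmall δ V →
          (∀ c : Site (F.P J) 0 → Matrix (Fin 2) (Fin 2) ℂ,
          (∀ e : PBond (F.P J) 0, c e.src = ((unitsField (toUField V) e : (Matrix (Fin 2) (Fin 2) ℂ)ˣ) : Matrix (Fin 2) (Fin 2) ℂ) * c e.tgt *
            (((unitsField (toUField V) e)⁻¹ : (Matrix (Fin 2) (Fin 2) ℂ)ˣ) : Matrix (Fin 2) (Fin 2) ℂ)) →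
          ∃ z : ℂ, ∀ y, c y = z • (1 : Matrix (Fin 2) (Fin 2) ℂ)) ∨
          (∃ g : GaugeTransf (F.P J) 0 (Matrix.specialUnitaryGroup (Fin 2) ℂ),
          (∀ e : PBond (F.P J) 0, Commute (((GaugeField.gaugeAct g V) e : Matrix.specialUnitaryGroup (Fin 2) ℂ) : Matrix (Fin 2) (Fin 2) ℂ) σ₃) ∧
          ∀ c : Site (F.P J) 0 → Matrix (Fin 2) (Fin 2) ℂ,
            (∀ e : PBond (F.P J) 0, c e.src = ((unitsField (toUField (GaugeField.gaugeAct g V)) e : (Matrix (Fin 2) (Fin 2) ℂ)ˣ) : Matrix (Fin 2) (Fin 2) ℂ) * c e.tgt *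
            (((unitsField (toUField (GaugeField.gaugeAct g V)) e)⁻¹ : (Matrix (Fin 2) (Fin 2) ℂ)ˣ) : Matrix (Fin 2) (Fin 2) ℂ)) →
            ∃ c₀ : Matrix (Fin 2) (Fin 2) ℂ, (∀ y, c y = c₀) ∧ Commute c₀ σ₃) ∨
          ∀ U₀ : GaugeField (F.P K) 0 (Matrix.specialUnitaryGroup (Fin 2) ℂ), U₀ ∈ regFibrePr F J K hlt.le ε₀ V →
            wilsonAction4 U₀ = minActionRegPr F J K hlt.le ε₀ V →
          ∀ δ' : ℝ, ∃ μ : ℝ, 0 < μ ∧ ∀ U ∈ fibre F ℰp J K hlt.le V,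
            U ∈ histGood F ℰp (θBal F.L γ b₀ p₀) K J →
          (∃ w : Site (F.P K) 0 → Matrix.specialUnitaryGroup (Fin 2) ℂ,
          (∀ U'' : GaugeField (F.P K) 0 (Matrix.specialUnitaryGroup (Fin 2) ℂ),
          descendTo F ℰp J K hlt.le (GaugeField.gaugeAct w U'') = descendTo F ℰp J K hlt.le U'') ∧
          ∀ ℓ : PBond (F.P K) 0, dist1 (U ℓ * ((GaugeField.gaugeAct w
            U₀) ℓ)⁻¹) ≤ δ') →
          μ * ((F.L : ℝ)⁻¹) ^ (2 * (K - J)) *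
          (⨅ w : {w : Site (F.P K) 0 → Matrix.specialUnitaryGroup (Fin 2) ℂ |
          ∀ U : GaugeField (F.P K) 0 (Matrix.specialUnitaryGroup (Fin 2) ℂ),
          descendTo F ℰp J K hlt.le (GaugeField.gaugeAct w U) = descendTo F ℰp J K hlt.le U},
          ∑ ℓ : PBond (F.P K) 0,
          dist1 (U ℓ * ((GaugeField.gaugeAct (w : Site (F.P K) 0 → Matrix.specialUnitaryGroup (Fin 2) ℂ)
            U₀) ℓ)⁻¹) ^ 2)
          ≤ wilsonAction4 U - minActionRegPr F J K hlt.le ε₀ V := by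
  obtain ⟨γ₁, hγ₁, hmain⟩ := exists_tubeGrowth_caseB_atMin L b₀ p₀ hb hp
  refine ⟨γ₁, hγ₁, ?_⟩
  intro F γ hFL hγ hγle J K hlt hk ε₀ hε₀ hr3 hr2 V δ hδ hV
  rcases irr_or_caseA_or_loopHol_central V with hirr | hA | ⟨x₀, hcen⟩
  · exact Or.inl hirr
  · exact Or.inr (Or.inl hA)
  · exact Or.inr (Or.inr fun U₀ hU₀ hmin δ' => hmain F γ hFL hγ hγle J K hlt hk ε₀ hε₀ hr3 hr2 V x₀ hcen δ hδ hV U₀ hU₀ hmin δ')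

end Summit.QuantumFields.YangMills.Theorems.FluctuationComparisonRegPrIntLS2BetaWindowStrataCaseB

end
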